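import Mathlib
import Summits.QuantumAdvantage.QuantumAdvantage.Theorems.LinnikCubicClassGroupsPureCubicClassNumberHardHondaPrimeSetup
import Summits.QuantumAdvantage.QuantumAdvantage.Theorems.LinnikCubicClassGroupsPureCubicClassNumberHardHonda25
import HarnessLib

/-!
# Honda's criterion for a prime radicand, case `p ≡ 2, 5 (mod 9)`: `3 ∤ h(ℚ(∛p))`

Route `LinnikCubicClassGroups` (rank-0 hypothesis-type target `PureCubicClassNumberHard`,
stmt-QuantumAdvantage-11826); classical arithmetic of pure cubic fields.  T. Honda (J. Number Theory
3 (1971), Theorem): `3 ∣ h(ℚ(∛m))` unless the radicand is of a few exceptional shapes; for a PRIME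
radicand `p` the answer is `3 ∣ h ⟺ p ≡ 1 (mod 3)`.  This file proves the case `p ≡ 2, 5 (mod 9)`
of `3 ∤ h` ([AouissiMayerIsmailiTalbiAzizi2020, Thm. 2.3 items (3)–(4)]: conductor `3q₁`, `9q₁`),
running the tree's `honda25` pipeline (Chevalley's ambiguous classes for `L = K(ζ₃)/ℚ(ζ₃)` with
two totally ramified primes and `ζ₃` not a norm) with the second ramified prime the WILD prime `𝔏`
above `3` instead of the prime above a second radicand prime `q`:

* `ramificationIdx_three_eq_three_of_mod_nine` — **Dedekind's first species**: for `3 ∤ m`,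
  `m ≢ ±1 (mod 9)`, the prime `3` is totally ramified in every cubic `K ∋ ∛m` (Eisenstein element
  `∛m − m`, valuation count);
* `exists_wild_prime` — in `L = K(ζ₃)`: the unique prime `𝔏 ∋ 3`, `e(𝔏 | F) = 3`, `e(𝔏 | 3) = 6`,
  `λ𝓞_L = 𝔏³` (`λ` a generator of `𝔏 ∩ 𝓞_F`), `𝔏 ≠ P`;
* `honda25_prime` — **for a prime `p ≡ 2, 5 (mod 9)` and every cubic number field `K ∋ ∛p`,
  `3 ∤ h(K)`** (census: only `P ∋ p` and `𝔏` ramify over `F`; `ζ₃` is not a norm since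
  `9 ∤ p² − 1`, tree `stub_zetaNotNorm`; then `stub_unitsNormOne9`, `stub_invariantIdealsPrincipal`,
  `honda25_norm_unit`, `stub_classNumber_not_dvd`).

HONEST FRAMING (block-2b rule): a kernel-checked classical theorem on class numbers of pure cubic
fields, NOT summit progress; the crux `PureCubicClassNumberHard` is hypothesis-type and untouched.

## References
* T. Honda, *Pure cubic fields whose class numbers are multiples of three*, J. Number Theory 3
  (1971) 7–12, Theorem. [Honda1971]
* S. Aouissi, D. C. Mayer, M. C. Ismaili, M. Talbi, A. Azizi, Period. Math. Hungar. 81 (2020),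
  Thm. 2.3. [AouissiMayerIsmailiTalbiAzizi2020]
* D. A. Marcus, *Number Fields*, 2nd ed. (2018), Ch. 3 (pure cubic fields: Dedekind's types). [Marcus2018]
-/

set_option linter.dupNamespace false

noncomputable section

open NumberField

open scoped Pointwise NumberField IntermediateField

namespace Summit.QuantumAdvantage.QuantumAdvantage.Theorems.LinnikCubicClassGroups

open Literature.NumberTheory.NumberFields IsDedekindDomain

/-! ### `3` is totally ramified in `ℚ(∛m)` for `m ≢ 0, ±1 (mod 9)` (Dedekind's first species) -/

/-- **Dedekind's first species.**  For a cubic number field `K ∋ α`, `α³ = m` with `3 ∤ m` and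
`m ≢ ±1 (mod 9)`, the prime `3` is totally ramified in `K`: every prime `v ∋ 3` of `𝓞 K` has
`e(v | 3) = 3`.  Proof: `π = α − m` satisfies the Eisenstein equation
`π³ = −(3mπ(π + m) + (m³ − m))` with `9 ∤ m³ − m`; comparing `v`-adic valuations,
`3 · v(π) = v(3) = e(v|3) ≤ 3` and `v(π) ≥ 1`. [cite: Marcus2018, Ch. 3 (pure cubic fields,
Dedekind's types)] [folklore] -/
theorem ramificationIdx_three_eq_three_of_mod_nine {K : Type*} [Field K] [NumberField K]
    {m : ℕ} (hm3 : ¬ 3 ∣ m) (hm1 : m % 9 ≠ 1) (hm8 : m % 9 ≠ 8)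
    (h3 : Module.finrank ℚ K = 3) {α : K} (hα : α ^ 3 = (m : K))
    (v : HeightOneSpectrum (𝓞 K)) (hv : (3 : 𝓞 K) ∈ v.asIdeal) :
    v.asIdeal.ramificationIdx ℤ = 3 := by
  classical
  haveI := v.isMaximal
  obtain ⟨θ, hθ⟩ := Honda1971.exists_ringOfIntegers_coe_eq_of_pow_three hα
  -- `m³ = 3k + m` with `3 ∤ k`
  have hle : m ≤ m ^ 3 := Nat.le_self_pow (by norm_num) m
  have h3dvd : 3 ∣ m ^ 3 - m := by
    have hm3' : m ^ 3 % 3 = (m % 3) ^ 3 % 3 := Nat.pow_mod m 3 3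
    have hlt : m % 3 < 3 := Nat.mod_lt _ (by norm_num)
    refine (Nat.modEq_iff_dvd' hle).mp ?_
    change m % 3 = m ^ 3 % 3
    interval_cases hr : m % 3 <;> simp [hm3']
  obtain ⟨k, hk⟩ := h3dvd
  have hnat : m ^ 3 = 3 * k + m := by omega
  have hk3 : ¬ 3 ∣ k := by
    rintro ⟨k', rfl⟩
    have hm9 : m ^ 3 % 9 = (m % 9) ^ 3 % 9 := Nat.pow_mod m 3 9
    have hlt : m % 9 < 9 := Nat.mod_lt _ (by norm_num)
    have h0 : ¬ 3 ∣ m % 9 := by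
      intro h; exact hm3 ((Nat.dvd_mod_iff (by norm_num : 3 ∣ 9)).mp h)
    interval_cases hr : m % 9 <;> simp at hm9 <;> omega
  -- the Eisenstein element `π = θ - m`
  set π : 𝓞 K := θ - (m : 𝓞 K) with hπdef
  have hθ3 : θ ^ 3 = (m : 𝓞 K) := by
    apply RingOfIntegers.coe_injective
    have h := hα
    rw [← hθ] at h
    push_cast at h ⊢
    exact_mod_cast h
  have h' : ((m : 𝓞 K)) ^ 3 = 3 * (k : 𝓞 K) + (m : 𝓞 K) := by exact_mod_cast hnat
  have hkey : π ^ 3 = -(3 * (m : 𝓞 K) * π * (π + m) + 3 * (k : 𝓞 K)) := by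
    rw [hπdef]
    linear_combination hθ3 - h'
  -- the prime `3ℤ` below `v`
  set P : Ideal ℤ := Ideal.span {(3 : ℤ)} with hPdef
  have hv' : ((3 : ℕ) : 𝓞 K) ∈ v.asIdeal := by exact_mod_cast hv
  have hunder : v.asIdeal.under ℤ = P := by
    have := Honda1971.under_int_eq_span Nat.prime_three v hv'
    simpa [hPdef] using this
  haveI : v.asIdeal.LiesOver P := ⟨hunder.symm⟩
  haveI : P.IsMaximal := hunder ▸ Ideal.IsMaximal.under ℤ v.asIdeal
  have hP0 : P ≠ ⊥ := by
    rw [hPdef, Ne, Ideal.span_singleton_eq_bot]; norm_num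
  have h30 : (3 : 𝓞 K) ≠ 0 := by norm_num
  have hPmap : P.map (algebraMap ℤ (𝓞 K)) = Ideal.span {(3 : 𝓞 K)} := by
    rw [hPdef, Ideal.map_span, Set.image_singleton, map_ofNat]
  have hPmap0 : P.map (algebraMap ℤ (𝓞 K)) ≠ ⊥ := by
    rw [hPmap, Ne, Ideal.span_singleton_eq_bot]; exact h30
  set e : ℕ := v.asIdeal.ramificationIdx ℤ with hedef
  have he : e = multiplicity v.asIdeal (Ideal.span {(3 : 𝓞 K)}) := by
    rw [hedef, Ideal.IsDedekindDomain.ramificationIdx_eq_multiplicity P v.asIdeal hPmap0, hPmap]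
  have hv3 : v.intValuation (3 : 𝓞 K) = WithZero.exp (-(e : ℤ)) := by
    rw [he]; exact v.intValuation_eq_exp_neg_multiplicity h30
  have hle3 : e ≤ 3 := by
    have h := Ideal.ramificationIdx_le_finrank (S := 𝓞 K) ℚ K v.asIdeal (p := P)
    rwa [Ideal.ramificationIdx'_eq_ramificationIdx P v.asIdeal hP0, h3] at h
  have hepos : 0 < e := Ideal.ramificationIdx_pos v.asIdeal ℤ
  -- `v(k) = 1`, `v(m) = 1`
  have hcop3 : ∀ {n : ℕ}, ¬ 3 ∣ n → v.intValuation (n : 𝓞 K) = 1 := by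
    intro n hn
    refine HeightOneSpectrum.intValuation_eq_one_iff.mpr ?_
    exact Honda1971.natCast_notMem_of_coprime
      ((Nat.Prime.coprime_iff_not_dvd Nat.prime_three).mpr hn) v hv'
  have hvk : v.intValuation (k : 𝓞 K) = 1 := hcop3 hk3
  have hvm : v.intValuation (m : 𝓞 K) = 1 := hcop3 hm3
  -- `π ≠ 0`
  have hk0 : (k : 𝓞 K) ≠ 0 := by
    intro hk0
    have : v.intValuation (k : 𝓞 K) = 0 := by rw [hk0, map_zero]
    rw [hvk] at this
    exact one_ne_zero this
  have hπ0 : π ≠ 0 := by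
    intro h0
    have h := hkey
    rw [h0, zero_pow (by norm_num), mul_zero, zero_mul, zero_add, eq_comm, neg_eq_zero,
      mul_eq_zero] at h
    rcases h with h | h
    · exact h30 h
    · exact hk0 h
  set a : ℕ := multiplicity v.asIdeal (Ideal.span {π}) with hadef
  have hvπ : v.intValuation π = WithZero.exp (-(a : ℤ)) :=
    v.intValuation_eq_exp_neg_multiplicity hπ0
  -- valuations of the two summands
  have hvB : v.intValuation (3 * (k : 𝓞 K)) = WithZero.exp (-(e : ℤ)) := by
    rw [map_mul, hv3, hvk, mul_one]
  have hvA : v.intValuation (3 * (m : 𝓞 K) * π * (π + m)) ≤ WithZero.exp (-(e : ℤ) + -(a : ℤ)) := by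
    rw [map_mul, map_mul, map_mul, hv3, hvm, hvπ, mul_one, WithZero.exp_add]
    calc WithZero.exp (-(e : ℤ)) * WithZero.exp (-(a : ℤ)) * v.intValuation (π + ↑m)
        ≤ WithZero.exp (-(e : ℤ)) * WithZero.exp (-(a : ℤ)) * 1 :=
          mul_le_mul_right (v.intValuation_le_one _) _
      _ = WithZero.exp (-(e : ℤ)) * WithZero.exp (-(a : ℤ)) := mul_one _
  have hvπ3 : v.intValuation (π ^ 3) = WithZero.exp (-(3 * (a : ℤ))) := by
    rw [map_pow, hvπ, ← WithZero.exp_nsmul]; congr 1; ring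
  -- case `a = 0` is impossible; otherwise `3a = e`
  by_cases ha : a = 0
  · exfalso
    have hlt : v.intValuation (π ^ 3) < 1 := by
      rw [hkey, Valuation.map_neg]
      refine Valuation.map_add_lt _ (lt_of_le_of_lt hvA ?_) ?_
      · rw [← WithZero.exp_zero, WithZero.exp_lt_exp]; omega
      · rw [hvB, ← WithZero.exp_zero, WithZero.exp_lt_exp]; omega
    rw [hvπ3, ha, ← WithZero.exp_zero, WithZero.exp_lt_exp] at hlt
    simp at hlt
  · have hlt : v.intValuation (3 * (m : 𝓞 K) * π * (π + m)) < v.intValuation (3 * (k : 𝓞 K)) := by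
      rw [hvB]
      refine lt_of_le_of_lt hvA ?_
      rw [WithZero.exp_lt_exp]; omega
    have hsum : v.intValuation (3 * (m : 𝓞 K) * π * (π + m) + 3 * (k : 𝓞 K)) =
        WithZero.exp (-(e : ℤ)) := by
      rw [Valuation.map_add_eq_of_lt_right _ hlt, hvB]
    have h3a : (3 : ℤ) * a = e := by
      have h := hvπ3
      rw [hkey, Valuation.map_neg, hsum, WithZero.exp_inj] at h
      linarith
    omega

/-! ### The prime of `L = K(ζ₃)` above `3` for `p ≡ 2, 5 (mod 9)` -/

/-- **The wild prime.**  For a prime `p ≡ 2, 5 (mod 9)`, a cubic `K ∋ ∛p`, a sextic `L ⊇ K` and a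
quadratic subfield `F ⊆ L` containing `ζ₃` with `L/F` Galois cubic and `𝓞_F` a PID: there is a
maximal ideal `𝔏 ∋ 3` of `𝓞 L`, the only one above `3`, totally ramified over `F`
(`e(𝔏 | F) = 3`), with `λ𝓞_L = 𝔏³` for a generator `λ` of `𝔏 ∩ 𝓞_F`, and different from any
ideal containing `p` (`3` is totally ramified in `K` — Dedekind's first species — and ramified in
`F = ℚ(ζ₃)`, so `e(𝔏 | 3) = 6`). [folklore] -/
theorem exists_wild_prime {p : ℕ} (hp : p.Prime) (hp9 : p % 9 = 2 ∨ p % 9 = 5)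
    {K : Type*} [Field K] [NumberField K] (hK : Module.finrank ℚ K = 3) {α : K}
    (hα : α ^ 3 = (p : K)) {L : Type*} [Field L] [NumberField L] [Algebra K L]
    (hL6 : Module.finrank ℚ L = 6) (F : IntermediateField ℚ L) [IsGalois F L]
    (hFL : Module.finrank F L = 3) (hF2 : Module.finrank ℚ F = 2)
    {ζ : 𝓞 F} (hζ : ζ ^ 2 + ζ + 1 = 0) (hPID : IsPrincipalIdealRing (𝓞 F))
    {P : Ideal (𝓞 L)} (hP : P.IsMaximal) (hpP : (p : 𝓞 L) ∈ P) :
    ∃ Q : Ideal (𝓞 L), Q.IsMaximal ∧ (3 : 𝓞 L) ∈ Q ∧ Q.ramificationIdx (𝓞 F) = 3 ∧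
      (∀ Q' : Ideal (𝓞 L), Q'.IsMaximal → (3 : 𝓞 L) ∈ Q' → Q' = Q) ∧
      (∃ t : 𝓞 F, Ideal.span {algebraMap (𝓞 F) (𝓞 L) t} = Q ^ 3) ∧ P ≠ Q := by
  classical
  haveI : Fact (Nat.Prime 3) := ⟨Nat.prime_three⟩
  haveI hFcyc : IsCyclotomicExtension {3} ℚ F := Honda1971.isCyclotomicExtension_three F hF2 hζ
  have hp3 : ¬ 3 ∣ p := by
    intro h; have := (Nat.prime_dvd_prime_iff_eq Nat.prime_three hp).mp h; omega
  have hm1 : p % 9 ≠ 1 := by omega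
  have hm8 : p % 9 ≠ 8 := by omega
  -- the prime `3ℤ`
  obtain ⟨𝔭, h𝔭def⟩ : ∃ 𝔭 : Ideal ℤ, 𝔭 = Ideal.span {((3 : ℕ) : ℤ)} := ⟨_, rfl⟩
  haveI h𝔭max : 𝔭.IsMaximal := h𝔭def ▸
    Ideal.IsPrime.isMaximal ((Ideal.span_singleton_prime (by norm_num)).mpr
      (Nat.prime_iff_prime_int.mp Nat.prime_three)) (by simp)
  have h𝔭0 : 𝔭 ≠ ⊥ := by rw [h𝔭def, Ne, Ideal.span_singleton_eq_bot]; norm_num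
  have hmem : ∀ (Q : Ideal (𝓞 L)) [Q.LiesOver 𝔭], (3 : 𝓞 L) ∈ Q := by
    intro Q _
    have h1 : ((3 : ℕ) : ℤ) ∈ Q.under ℤ := by
      rw [← Ideal.over_def Q 𝔭, h𝔭def]
      exact Ideal.mem_span_singleton_self _
    rw [Ideal.under_def, Ideal.mem_comap, map_natCast] at h1
    exact_mod_cast h1
  -- through `K`: `3 ∣ e(Q | 3)`; through `F`: `e(Q | F) = 3` and `e(Q | 3) = 2 · 3 = 6`
  have heK : ∀ (Q : Ideal (𝓞 L)) [Q.IsMaximal] [Q.LiesOver 𝔭],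
      Q.ramificationIdx ℤ = 3 * Q.ramificationIdx (𝓞 K) := by
    intro Q _ _
    haveI : (Q.under (𝓞 K)).IsMaximal := Ideal.IsMaximal.under _ Q
    have hne : Q.under (𝓞 K) ≠ ⊥ := Ideal.IsMaximal.ne_bot_of_isIntegral_int _
    let v : HeightOneSpectrum (𝓞 K) := ⟨Q.under (𝓞 K), Ideal.IsMaximal.isPrime inferInstance, hne⟩
    have h3v : (3 : 𝓞 K) ∈ v.asIdeal := by
      change (3 : 𝓞 K) ∈ Q.under (𝓞 K)
      rw [Ideal.under_def, Ideal.mem_comap, map_ofNat]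
      exact hmem Q
    have h3 : (Q.under (𝓞 K)).ramificationIdx ℤ = 3 :=
      ramificationIdx_three_eq_three_of_mod_nine hp3 hm1 hm8 hK hα v h3v
    rw [Ideal.ramificationIdx_tower (R := ℤ) (Q.under (𝓞 K)) Q, h3]
  have heF : ∀ (Q : Ideal (𝓞 L)) [Q.IsMaximal] [Q.LiesOver 𝔭], Q.ramificationIdx (𝓞 F) = 3 := by
    intro Q _ _
    exact Honda1971.ramificationIdx_eq_three_of_three_dvd (F := F) (L := L) hFL hF2 Q
      ⟨_, heK Q⟩
  have he6 : ∀ (Q : Ideal (𝓞 L)) [Q.IsMaximal] [Q.LiesOver 𝔭], Q.ramificationIdx ℤ = 6 := by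
    intro Q _ _
    haveI : (Q.under (𝓞 F)).IsMaximal := Ideal.IsMaximal.under _ Q
    haveI : (Q.under (𝓞 F)).LiesOver (Ideal.span {((3 : ℕ) : ℤ)}) := h𝔭def ▸ inferInstance
    have h2 : (Q.under (𝓞 F)).ramificationIdx ℤ = 3 - 1 :=
      IsCyclotomicExtension.Rat.ramificationIdx_eq_of_prime 3 F (Q.under (𝓞 F))
    rw [Ideal.ramificationIdx_tower (R := ℤ) (Q.under (𝓞 F)) Q, h2, heF Q]
  -- a prime above `3`; it is the only one (fundamental identity `∑ e f = 6`)
  obtain ⟨Q, hQmax, hQover⟩ := Ideal.exists_maximal_ideal_liesOver_of_isIntegral (S := 𝓞 L) 𝔭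
  have hsum := Ideal.sum_ramification_inertia_eq_finrank 𝔭 (𝓞 L)
  rw [RingOfIntegers.rank, hL6] at hsum
  let Q' : 𝔭.primesOver (𝓞 L) := ⟨Q, hQmax.isPrime, hQover⟩
  have hge : ∀ R : 𝔭.primesOver (𝓞 L), 6 ≤ R.1.ramificationIdx ℤ * R.1.inertiaDeg ℤ := by
    rintro ⟨R, hRp, hRl⟩
    haveI : R.IsMaximal := Ideal.IsMaximal.of_liesOver_isMaximal R 𝔭
    have h1 := he6 R
    have h4 : 0 < R.inertiaDeg ℤ := Ideal.inertiaDeg_pos _ _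
    change 6 ≤ R.ramificationIdx ℤ * R.inertiaDeg ℤ
    rw [h1]
    nlinarith
  have huniq : ∀ R : 𝔭.primesOver (𝓞 L), R = Q' := by
    intro R
    by_contra hne
    have h2 : ∑ x ∈ ({R, Q'} : Finset (𝔭.primesOver (𝓞 L))),
        x.1.ramificationIdx ℤ * x.1.inertiaDeg ℤ ≤ 6 := by
      rw [← hsum]
      exact Finset.sum_le_sum_of_subset (Finset.subset_univ _)
    rw [Finset.sum_pair hne] at h2
    have := hge R
    have := hge Q'
    omega
  have huniq' : ∀ R : Ideal (𝓞 L), R.IsMaximal → (3 : 𝓞 L) ∈ R → R = Q := by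
    intro R hR h3R
    have hRu : R.under ℤ = 𝔭 := by
      have hne : R ≠ ⊥ := Ideal.IsMaximal.ne_bot_of_isIntegral_int R
      let w : HeightOneSpectrum (𝓞 L) := ⟨R, hR.isPrime, hne⟩
      have := Honda1971.under_int_eq_span Nat.prime_three w (by exact_mod_cast h3R)
      rw [h𝔭def]; exact this
    haveI : R.LiesOver 𝔭 := ⟨hRu.symm⟩
    exact congrArg Subtype.val (huniq ⟨R, hR.isPrime, inferInstance⟩)
  refine ⟨Q, hQmax, hmem Q, heF Q, huniq', ?_, ?_⟩
  · -- `λ𝓞_L = Q³` for `λ` a generator of `Q ∩ 𝓞_F`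
    haveI := hPID
    haveI : (Q.under (𝓞 F)).IsMaximal := Ideal.IsMaximal.under _ Q
    have hq0 : Q.under (𝓞 F) ≠ ⊥ := Ideal.IsMaximal.ne_bot_of_isIntegral_int _
    obtain ⟨t, ht⟩ := (IsPrincipalIdealRing.principal (Q.under (𝓞 F))).principal
    refine ⟨t, ?_⟩
    have hM : (Q.under (𝓞 F)).map (algebraMap (𝓞 F) (𝓞 L)) =
        Ideal.span {algebraMap (𝓞 F) (𝓞 L) t} := by
      rw [ht, Ideal.submodule_span_eq, Ideal.map_span, Set.image_singleton]
    rw [← hM, Ideal.map_algebraMap_eq_finsetProd_pow (R := 𝓞 L) hq0]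
    have hset : (Ideal.primesOver (Q.under (𝓞 F)) (𝓞 L)).toFinset = {Q} := by
      ext R
      simp only [Set.mem_toFinset, Finset.mem_singleton]
      constructor
      · intro hR
        haveI := hR.1
        haveI := hR.2
        haveI : R.IsMaximal := hR.1.isMaximal (Ideal.ne_bot_of_mem_primesOver hq0 hR)
        haveI : R.LiesOver 𝔭 := Ideal.LiesOver.trans R (Q.under (𝓞 F)) 𝔭
        exact huniq' R inferInstance (hmem R)
      · rintro rfl
        exact ⟨hQmax.isPrime, ⟨rfl⟩⟩
    rw [hset, Finset.prod_singleton, heF Q]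
  · -- `P ≠ Q`: `p ∈ P`, `3 ∈ Q`, `(p, 3) = 1`
    rintro rfl
    have hcop : IsCoprime (p : 𝓞 L) (3 : 𝓞 L) := by
      have h' : IsCoprime (p : ℤ) (3 : ℤ) :=
        Nat.isCoprime_iff_coprime.mpr ((Nat.coprime_primes hp Nat.prime_three).mpr (by omega))
      simpa using h'.map (Int.castRingHom (𝓞 L))
    obtain ⟨a, b, hab⟩ := hcop
    exact hP.ne_top ((Ideal.eq_top_iff_one _).mpr
      (hab ▸ P.add_mem (P.mul_mem_left a hpP) (P.mul_mem_left b (hmem P))))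

/-! ### Honda's criterion for a prime radicand `p ≡ 2, 5 (mod 9)` -/

/-- **Honda's criterion, case `m = p ≡ 2, 5 (mod 9)`** (Honda 1971, Theorem;
[AouissiMayerIsmailiTalbiAzizi2020, Thm. 2.3 items (3)–(4)]: conductor `f = 3q₁` or `9q₁`): for a
prime `p ≡ 2, 5 (mod 9)` and every cubic number field `K ∋ ∛p`, `3 ∤ h_K`.  Proof (Chevalley's
ambiguous classes for `L = K(ζ₃)/F = ℚ(ζ₃)`): exactly the prime `P` above the inert `p` and the
prime `𝔏` above `3` ramify (totally; `P³ = (p)`, `𝔏³ = (λ)`), `ζ₃` is not a norm from `L` (local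
obstruction at `P`: `ζ₃` is not a cube in `𝔽_{p²}` as `9 ∤ p² − 1`), so there are nine norm-one
units modulo coboundaries, every `σ`-invariant ideal is principal, every invariant class is trivial
and `3 ∤ h_L`; but `3 ∣ h_K ⟹ 3 ∣ h_L`.  (The tree's `honda25` pipeline with the second ramified prime
`P₂ = 𝔏` in place of the prime above `q`.) [cite: Honda1971, Theorem]
[cite: AouissiMayerIsmailiTalbiAzizi2020, Thm. 2.3 items (3)–(4)] -/
theorem honda25_prime (p : ℕ) (hp : p.Prime) (hp9 : p % 9 = 2 ∨ p % 9 = 5)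
    (K : Type) [Field K] [NumberField K] (hK : Module.finrank ℚ K = 3)
    (hα : ∃ α : K, α ^ 3 = (p : K)) : ¬ 3 ∣ classNumber K := by
  classical
  intro h3K
  obtain ⟨α, hα⟩ := hα
  have hp3 : p % 3 = 2 := by omega
  obtain ⟨hKL, hL6, hGal, F, hgal, hFL, hF2, ⟨σ, hσ⟩, hPID, hcplx, ⟨θ, hθ, hθdeg⟩, ζ, hζ3, hζ1,
    hζeq, hunits, P, hP, hpP, hspan, heP, h3P, hcardP⟩ :=
    fieldSetup_prime hp hp3 K hK hα (CyclotomicField 3 K)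
  haveI := hgal
  haveI := hGal
  have h3L : 3 ∣ classNumber (CyclotomicField 3 K) :=
    Honda1971.dvd_classNumber_of_dvd_classNumber_of_not_dvd_finrank
      (K := K) (L := CyclotomicField 3 K) Nat.prime_three h3K (by rw [hKL]; norm_num)
  obtain ⟨Q, hQ, h3Q, heQ, hQuniq, ht₂, hPQ⟩ :=
    exists_wild_prime hp hp9 hK hα hL6 F hFL hF2 hζeq hPID hP hpP
  -- the ramification census: only `P` and `Q` ramify over `F`
  have hgen : IntermediateField.adjoin F {θ} = ⊤ := Honda1971.adjoin_eq_top_of_finrank F hF2 hFL hθdeg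
  have hcensus : ∀ R : Ideal (𝓞 (CyclotomicField 3 K)), R.IsMaximal →
      R.ramificationIdx (𝓞 F) ≠ 1 → R = P ∨ R = Q := by
    intro R hR hram
    by_contra hnot
    push Not at hnot
    have hpR : (p : 𝓞 (CyclotomicField 3 K)) ∉ R := by
      intro hpR
      have hle : P ^ 3 ≤ R := by
        rw [← hspan, Ideal.span_singleton_le_iff_mem]
        exact hpR
      have hPR : P ≤ R :=
        (Ideal.IsPrime.pow_le_iff (I := P) (hP := hR.isPrime) (by norm_num)).mp hle
      exact hnot.1 (hP.eq_of_le hR.ne_top hPR).symm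
    have h3R : (3 : 𝓞 (CyclotomicField 3 K)) ∉ R := fun h => hnot.2 (hQuniq R hR h)
    haveI := hR
    have hunr : Algebra.IsUnramifiedAt (𝓞 F) R :=
      Honda1971.isUnramifiedAt_of_cube_eq (a := ((p : ℕ) : 𝓞 F)) (β := θ)
        (by rw [hθ, map_natCast]) hgen R h3R (by rw [map_natCast]; exact hpR)
    exact hram (Ideal.ramificationIdx_eq_one_iff.mpr hunr)
  have ht₁ : ∃ t : 𝓞 F, Ideal.span {algebraMap (𝓞 F) (𝓞 (CyclotomicField 3 K)) t} = P ^ 3 :=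
    ⟨p, by simpa using hspan⟩
  -- `ζ₃` is not a norm from `L` (local obstruction at `P`: `9 ∤ p² − 1`)
  have h9 : ¬ 9 ∣ Nat.card ((𝓞 F) ⧸ P.under (𝓞 F)) - 1 := by
    rw [hcardP]
    rcases hp9 with h | h
    · have h1 : p ^ 2 % 9 = 4 := by rw [Nat.pow_mod, h]
      omega
    · have h1 : p ^ 2 % 9 = 7 := by rw [Nat.pow_mod, h]
      omega
  have hnn : ∀ x : CyclotomicField 3 K, Algebra.norm F x ≠ ((ζ : 𝓞 F) : F) :=
    stub_zetaNotNorm F (CyclotomicField 3 K) hFL (ζ : 𝓞 F) hζ3 hζ1 P hP heP ht₁ h3P h9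
  have hu1 : ∀ ε : (𝓞 (CyclotomicField 3 K))ˣ,
      Algebra.norm F (((ε : 𝓞 (CyclotomicField 3 K)) : CyclotomicField 3 K)) ≠ ((ζ : 𝓞 F) : F) :=
    fun ε => hnn _
  have hu2 : ∀ w : (𝓞 F)ˣ, ∃ i : ℕ, ∃ v : (𝓞 F)ˣ, w = ζ ^ i * v ^ 3 := by
    intro w
    obtain ⟨i, hi | hi⟩ := hunits w
    · exact ⟨i, 1, by rw [hi]; simp⟩
    · exact ⟨i, -1, by rw [hi]; norm_num⟩
  have hnine := stub_unitsNormOne9 F (CyclotomicField 3 K) σ hσ hFL hcplx ζ hu1 hu2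
  have hprinc : ∀ I : Ideal (𝓞 (CyclotomicField 3 K)), I ≠ ⊥ → σ • I = I →
      Submodule.IsPrincipal I :=
    stub_invariantIdealsPrincipal F (CyclotomicField 3 K) σ hσ hFL hPID P Q hP hQ hPQ ht₁ ht₂
      hcensus hnine
  have hH3 := honda25_norm_unit F (CyclotomicField 3 K) hFL ζ hζ3 hunits hnn
  exact stub_classNumber_not_dvd F (CyclotomicField 3 K) σ hσ hFL hH3 hprinc h3L

end Summit.QuantumAdvantage.QuantumAdvantage.Theorems.LinnikCubicClassGroups

end
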